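import Literature.MathematicalPhysics.QuantumFieldTheory.Balaban1983to89.B11Eq7Convention

/-!
# `Balaban1983to89.B11Rem278` — T. Bałaban, *The variational problem and background fields in renormalization group
# method for lattice gauge theories*, Commun. Math. Phys. **102** (1985) 277–309 [Balaban1985Variational], the remark
# after (7), p. 278: *"if the space (6) is non-empty and ε₀ is sufficiently small, then by Proposition 2 [4] the
# configuration V satisfies (7) with ε₁ = O(ε₀)"* — PROVED for the concrete multi-level model on `ℤ^d` of
# `B11Eq7Convention` ((2) = `B8Ineq132.InAk`, (3) = `InB`, (7) with its printed boundary convention = `Reg7`), and the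
# row's typed shape `B11.Prop2OfB7Shape` DISCHARGED for that model family

statement-level skeleton of published theorems with citation tags; proofs where landed; nothing here is a claim
about the Yang–Mills mass gap

PDF held: `paper:balaban1985-cmp102-variational-background` (journal page = PDF page + 276); p. 278 (PDF 2) read from
the held text AND the x2 render `…/1985-cmp102-variational-background-p002-x2.png` (as an image).  "[4]" = T. Bałaban,
*Averaging operations for lattice gauge theories*, CMP **98** (1985) 17–51 [Balaban1985Averaging] (B7), Proposition 2
(52)–(54) p. 26 with its printed locality, PROVED in the tree for the concrete average (42)/(43) on `ℤ^d`
(`B7Prop2Explicit`, `B7Prop2SpecialUnitary`, `B7Prop1Local.prop2_local_at`, locality `B7Prop1Local.bavg_congr`);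
[6] = CMP **99** (1985) 75–102 [Balaban1985RegularSpaces] (B8), Sect. A.  The objects (3), (7), `Λ_j` and the
admissibility (1) are those of the companion `B11Eq7Convention` (same seat; printed text of (2)–(7), notes (M1)–(M4)).

WHAT IS REPRODUCED.  SKELETON row `B11.Rem@278` (reader r08 `ROWS-B11.md`: «if the space (6) is non-empty and ε₀ is
sufficiently small, then by Proposition 2 [4] the configuration V satisfies (7) with ε₁ = O(ε₀)», decl
`B11.Prop2OfB7Shape`, typed-existing over the abstract carrier `B11.VarProblem`).  Mega-formalization `lit-balaban`,
HOME `run/shared/lean/pub/lit-balaban/`, Phase-2 proof seat `p29` gen 3, unit `lit-balaban-p29` (kind «model-instance»: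
the Prop of record quantifies over abstract carrier data; it is proved here for the CONCRETE family
`B11Eq7Convention.concreteVarProblem` — (2), (3), (7) concrete, every field of `B11.VarProblem` the remark does not
mention universally quantified).

THE PRINTED TEXT (p. 278, verbatim, following the explanation of (7) quoted in `B11Eq7Convention`).  *"Let us
notice that if the space (6) is non-empty and ε₀ is sufficiently small, then by Proposition 2 [4] the configuration V
satisfies (7) with ε₁ = O(ε₀). Hence our assumption has a meaning only for ε₁ smaller than ε₀."*

THE ARGUMENT FORMALISED (print: "by Proposition 2 [4]").  Let `U ∈ 𝔘_k({Ω_j}, ε₀) ∩ 𝔅_k(𝔅_k, V)` and let `p′` be a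
plaquette of the `L^jη`-lattice entering (7) at level `j` (`B11Eq7Convention.PlaqB`).  STEP 1 (`plaqF_effCfg_eq`):
`(∂V)(p′) = Ū^j(∂p′)` bond by bond — a bond `b` of `p′` touching `Λ_j` carries `V_b = Ū^j_b` by (3) at level `j`; a
bond `b = ⟨y,z⟩` outside `Λ_j` carries `V̄_b`, the one-step average (42) of the level-`(j−1)` data, which by the
locality of (42) ([4] p. 24, `bavg_congr`) only involves the level-`(j−1)` bonds of `B(y) ∪ B(z)`; these lie in
`Λ_{j−1}` ("it means that y, z ∈ Λ_{j−1}" — here from (1): `B^j(y) ∪ B^j(z) ⊂ Ω_{j−1} \ Ω_j`), so (3) at level `j−1`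
gives `V = Ū^{j−1}` there and `V̄_b = \overline{Ū^{j−1}}_b = Ū^j_b` (43).  STEP 2 (`pdevOn_corners_lt`): the
hypothesis (52) of Prop. 2 [4] with its printed locality — on the four `j`-blocks at the corners of `p′` — follows
from (2): these blocks lie in `Ω_{j−1}` (by (1); the inner ones even in `Ω_j`), where (2) at level `j−1` gives
`|U(∂p) − 1| < ε₀L^{−2(j−1)} = L²ε₀·η_j²`, `η_j = L^{−j}` — i.e. (52) with `α₀ = L²ε₀`; for `j = 0`, `Ω₀ = T_η`.
STEP 3: Prop. 2 (54) of [4] (`B7Prop1Local.prop2_local_at`): `|Ū^j(∂p′) − 1| < α₀ + 2C₀α₀² < 2α₀ = 2L²ε₀`.  Hence (7)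
with `ε₁ = 2L²ε₀ = O(ε₀)` (`L` is fixed, [4] p. 17) for `L⁴ε₀ ≤ 1/(3C₀(d))` ("ε₀ sufficiently small"); for the
plaquettes `p′ ⊂ Ω_j^{(j)}` (in particular `p′ ⊂ Λ_j`, print's "simple" case) the four blocks lie in `Ω_j` and `ε₁ =
2ε₀` (`reg7_interior_at`).

MODEL / DECLARED DEVIATIONS (in addition to (M1)–(M4) of `B11Eq7Convention`).  (M5) SMALLNESS/CONSTANTS: "ε₀
sufficiently small", `L` fixed: one threshold `L⁴ε₀ ≤ 1/(3C₀(d))` (`smallness_of_L4`); `O(ε₀) = 2L²ε₀` (the OUTER corner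
blocks of a boundary plaquette only lie in `Ω_{j−1}`, where (2) is weaker by `L²`), `2ε₀` for interior plaquettes.
(M6) GAUGE GROUP: [4] has `G ⊂ U(N)`: the explicit theorems are stated for any gauge group closed under (42) at radius
`t` (`B7Prop2SpecialUnitary.AvgClosedAt`, e.g. `SU(N)`), the discharge of `B11.Prop2OfB7Shape` for any `AvgClosed`
group (radius `1/4`: `U(N)`, the unitary group of a C⋆-algebra; `prop2OfB7Shape_unitaryGroup` is `G = U(N) ⊂ M_N(ℂ)`
with the operator norm).  (M7) `L ≥ 2` ([4] p. 17 "`L > 1`").  The divergence clause of (2) is part of the hypothesis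
`InAk` and, exactly as in print, plays no role.  Net new unproved facts: 0.
-/

noncomputable section

open scoped BigOperators
open NormedSpace Finset

namespace Literature.MathematicalPhysics.QuantumFieldTheory.Balaban1983to89.B11Rem278

open B7Prop1Explicit B7Prop2Explicit B7Prop2SpecialUnitary B7Prop1Local B8Ineq132 MatrixLog B11Eq7Convention
open B8ConstraintBonds (DomainSeq)

-- `Site` alone could resolve to the torus sites of `Setup.lean`; re-export the `ℤ^d` sites of `B7Prop1Explicit`.
export B7Prop1Explicit (Site)

variable {d : ℕ}

/-! ## §3 Step 1: `(∂V)(p′) = Ū^j(∂p′)` -/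

section Identity

variable {𝔸 : Type*} [NormedRing 𝔸] [NormOneClass 𝔸] [NormedAlgebra ℂ 𝔸] [CompleteSpace 𝔸]

omit [NormOneClass 𝔸] in
/-- One bond of `p′`: the recipe of (7) gives `Ū^j_b` — by (3) at level `j` if `b` touches `Λ_j`, and otherwise by
(3) at level `j−1` on `B(y) ∪ B(z) ⊂ Λ_{j−1}` and the locality of (42)/(43) ([4] p. 24).
[cite: Balaban1985Variational, p.278 (explanation of (7)); Balaban1985Averaging, (43) p.24] -/
theorem effCfg_eq_avgIter {L k : ℕ} (hL : 1 ≤ L) {Ω : ℕ → Set (Site d)} (hΩ : DomainSeq L Ω)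
    (h0 : Ω 0 = Set.univ) {V : ℕ → Site d → Fin d → 𝔸ˣ} {U : Site d → Fin d → 𝔸ˣ} (hB : InB L k Ω V U) {j : ℕ}
    (hjk : j ≤ k)
    {y : Site d} {μ ν : Fin d} (hμν : μ ≠ ν) (hp : PlaqTouches (Lam L Ω k j) y μ ν) {x : Site d} {κ : Fin d}
    (hx : IsCorner y μ ν x) (hxκ : IsCorner y μ ν (x + e κ)) (hok : BondOK L k Ω j x κ) :
    effCfg L k Ω V j x κ = avgIter L U j x κ := by
  obtain ⟨y₀, hy₀c, hy₀⟩ := exists_corner_of_plaqTouches hp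
  cases j with
  | zero =>
    have ht : BondTouches (Lam L Ω k 0) x κ := by
      rcases hok with h | h
      · exact h
      · exact absurd (h0 ▸ Set.mem_univ _) h.1
    exact (hB 0 hjk x κ ht).symm
  | succ j =>
    by_cases ht : BondTouches (Lam L Ω k (j + 1)) x κ
    · simp only [effCfg, ht, if_true]
      exact (hB (j + 1) hjk x κ ht).symm
    · simp only [effCfg, ht, if_false]
      rcases hok with h | ⟨hx1, hx2⟩
      · exact absurd h ht
      show rescale L (bavg L (V j)) x κ = rescale L (bavg L (avgIter L U j)) x κ
      simp only [rescale_apply]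
      refine bavg_congr L hL _ κ fun w κ' hw _ => (hB j (by omega) w κ' (Or.inl ?_)).symm
      show loK L j w ∈ layer Ω k j
      rcases under_of_bondBox hL j hw with hu | hu
      · exact mem_layer_of_under_corner hL hΩ hμν hy₀c hy₀ hx hx1 hu
      · exact mem_layer_of_under_corner hL hΩ hμν hy₀c hy₀ hxκ hx2 hu

omit [NormOneClass 𝔸] in
/-- **`(∂V)(p′) = Ū^j(∂p′)`** for every plaquette of (7) and every `U ∈ 𝔅_k(𝔅_k, V)` (admissible domains).
[cite: Balaban1985Variational, p.278 (explanation of (7) and the remark)] -/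
theorem plaqF_effCfg_eq {L k : ℕ} (hL : 1 ≤ L) {Ω : ℕ → Set (Site d)} (hΩ : DomainSeq L Ω)
    (h0 : Ω 0 = Set.univ) {V : ℕ → Site d → Fin d → 𝔸ˣ} {U : Site d → Fin d → 𝔸ˣ} (hB : InB L k Ω V U) {j : ℕ}
    (hjk : j ≤ k) {y : Site d} {μ ν : Fin d} (hμν : μ ≠ ν) (hp : PlaqB L k Ω j y μ ν) :
    plaqF (effCfg L k Ω V j) μ ν y = plaqF (avgIter L U j) μ ν y := by
  obtain ⟨ht, h1, h2, h3, h4⟩ := hp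
  have c0 : IsCorner y μ ν y := Or.inl rfl
  have cμ : IsCorner y μ ν (y + e μ) := Or.inr (Or.inl rfl)
  have cν : IsCorner y μ ν (y + e ν) := Or.inr (Or.inr (Or.inl rfl))
  have cμν : IsCorner y μ ν (y + e μ + e ν) := Or.inr (Or.inr (Or.inr rfl))
  have cνμ : IsCorner y μ ν (y + e ν + e μ) := Or.inr (Or.inr (Or.inr (add_right_comm _ _ _)))
  unfold plaqF
  rw [hol_plaqWord_eq, hol_plaqWord_eq, effCfg_eq_avgIter hL hΩ h0 hB hjk hμν ht c0 cμ h1,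
    effCfg_eq_avgIter hL hΩ h0 hB hjk hμν ht cμ cμν h2, effCfg_eq_avgIter hL hΩ h0 hB hjk hμν ht cν cνμ h3,
    effCfg_eq_avgIter hL hΩ h0 hB hjk hμν ht c0 cν h4]

end Identity

/-! ## §4 Step 2: (2) gives the local hypothesis (52) of Prop. 2 [4] on the corner blocks, with `α₀ = L²ε₀` -/

section Corners

variable {𝔸 : Type*} [NormedRing 𝔸] [NormOneClass 𝔸] [NormedAlgebra ℂ 𝔸] [CompleteSpace 𝔸]

omit [NormOneClass 𝔸] [CompleteSpace 𝔸] in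
/-- **(52) on the four corner blocks from (2):** for a plaquette of (7) at level `j` and `U ∈ 𝔘_k({Ω_j}, ε₀)`,
`sup |U(∂p) − 1| < L²ε₀·L^{−2j}` over the fine plaquettes in `B^j(x) ∪ B^j(y) ∪ B^j(z) ∪ B^j(w)` (these blocks lie in
`Ω_{j−1}`, where (2) reads `ε₀L^{−2(j−1)}`; `Ω₀ = T_η` for `j = 0`). [cite: Balaban1985Variational, (2) p.278, p.278 (remark after (7)); Balaban1985Averaging, (52) p.26] -/
theorem pdevOn_corners_lt {L k : ℕ} (hL : 1 ≤ L) {Ω : ℕ → Set (Site d)} (hΩ : DomainSeq L Ω)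
    (h0 : Ω 0 = Set.univ) {η ε₀ : ℝ} (hε : 0 < ε₀) {U : Site d → Fin d → 𝔸ˣ} (hA : InAk L k η ε₀ Ω U) {j : ℕ}
    (hjk : j ≤ k) {y : Site d} {μ ν : Fin d} (hμν : μ ≠ ν) (hp : PlaqTouches (Lam L Ω k j) y μ ν) :
    pdevOn (loK L j y) (plaqHiK L j y μ ν) U < (L : ℝ) ^ 2 * ε₀ * (((L : ℝ) ^ j)⁻¹) ^ 2 := by
  have hLr : (1 : ℝ) ≤ L := by exact_mod_cast hL
  have hpos : (0 : ℝ) < (L : ℝ) ^ 2 * ε₀ * (((L : ℝ) ^ j)⁻¹) ^ 2 := by positivity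
  refine pdevOn_lt_of_forall hpos fun x μ' ν' hx _ => ?_
  rcases eq_or_ne μ' ν' with rfl | hne
  · rw [hol_plaqWord_self, Units.val_one, sub_self, norm_zero]; exact hpos
  -- the corner `x` of the fine plaquette lies in `Ω_{j-1}` (`Ω_0` for `j = 0`)
  cases j with
  | zero =>
    have h := (hA 0 hjk).1 x μ' ν' hne (Or.inl (h0 ▸ Set.mem_univ x))
    refine h.trans_le ?_
    simp only [pow_zero, inv_one, one_pow, mul_one]
    nlinarith [one_le_pow₀ (n := 2) hLr]
  | succ j =>
    obtain ⟨y₀, hy₀c, hy₀⟩ := exists_corner_of_plaqTouches hp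
    have hxΩ : x ∈ Ω j := by
      refine mem_of_fatBlock hL hΩ hy₀.1 fun i => ?_
      have hP : (0 : ℤ) ≤ (L : ℤ) ^ (j + 1) := by positivity
      have hb := hy₀c.bounds hμν i
      have h := hx i
      simp only [loK, plaqHiK] at h
      have h1 : (L : ℤ) ^ (j + 1) * (y₀ i - 1) ≤ (L : ℤ) ^ (j + 1) * y i :=
        mul_le_mul_of_nonneg_left (by split_ifs at hb <;> omega) hP
      have h2 : (L : ℤ) ^ (j + 1) * y i + ((L : ℤ) ^ (j + 1) - 1) +
          (if i = μ ∨ i = ν then (L : ℤ) ^ (j + 1) else 0) + 1 ≤ (L : ℤ) ^ (j + 1) * (y₀ i + 2) := by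
        split_ifs at hb ⊢ <;> nlinarith
      exact ⟨h1.trans h.1, by linarith [h.2]⟩
    have h := (hA j (by omega)).1 x μ' ν' hne (Or.inl hxΩ)
    refine h.trans_eq ?_
    have hL0 : (L : ℝ) ≠ 0 := by positivity
    field_simp
    ring

end Corners

/-! ## §5 Step 3: Proposition 2 [4] — the remark, explicit -/

section Main

variable {𝔸 : Type*} [NormedRing 𝔸] [NormOneClass 𝔸] [NormedAlgebra ℂ 𝔸] [CompleteSpace 𝔸]

/-- **"ε₀ sufficiently small" made explicit, one threshold (M5):** `L⁴ε₀ ≤ 1/(3C₀(d))`, `L ≥ 1` ⟹ the three smallness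
conditions of Prop. 2 of [4] at `α₀ = L²ε₀`: `C₀α₀ ≤ ⅓`, `2α₀ ≤ c₂′(d, L)`, and the closure radius
`32(d+1)(d+4)L²α₀ ≤ 1/4`. [cite: Balaban1985Variational, p.278 (remark after (7)); Balaban1985Averaging, Prop. 2 p.26] -/
theorem smallness_of_L4 {L : ℕ} (hL : 1 ≤ L) {ε₀ : ℝ} (hε : 0 ≤ ε₀) (h : (L : ℝ) ^ 4 * ε₀ ≤ 1 / (3 * C0 d)) :
    C0 d * ((L : ℝ) ^ 2 * ε₀) ≤ 1 / 3 ∧ 2 * ((L : ℝ) ^ 2 * ε₀) ≤ c2' d L ∧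
      32 * ((d : ℝ) + 1) * (d + 4) * (L : ℝ) ^ 2 * ((L : ℝ) ^ 2 * ε₀) ≤ 1 / 4 := by
  have hLr : (1 : ℝ) ≤ L := by exact_mod_cast hL
  have hC := C0_pos d
  have hd0 : (0 : ℝ) ≤ d := Nat.cast_nonneg d
  have hL2 : (1 : ℝ) ≤ (L : ℝ) ^ 2 := one_le_pow₀ hLr
  have h4 : (L : ℝ) ^ 4 * ε₀ = (L : ℝ) ^ 2 * ((L : ℝ) ^ 2 * ε₀) := by ring
  -- `C₀ L⁴ ε₀ ≤ 1/3`
  have h1 : C0 d * ((L : ℝ) ^ 4 * ε₀) ≤ 1 / 3 := by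
    have := mul_le_mul_of_nonneg_left h hC.le
    rwa [show C0 d * (1 / (3 * C0 d)) = 1 / 3 by field_simp] at this
  have hε2 : (L : ℝ) ^ 2 * ε₀ ≤ (L : ℝ) ^ 4 * ε₀ := by
    rw [h4]; exact le_mul_of_one_le_left (by positivity) hL2
  have hA : C0 d * ((L : ℝ) ^ 2 * ε₀) ≤ 1 / 3 := (mul_le_mul_of_nonneg_left hε2 hC.le).trans h1
  have hpos : (0 : ℝ) < 512 * ((d : ℝ) + 1) * (d + 4) * (L : ℝ) ^ 2 := by positivity
  have hK : 1024 * ((d : ℝ) + 1) * (d + 4) ≤ C0 d := by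
    unfold C0; nlinarith [sq_nonneg ((d : ℝ) + 1), sq_nonneg ((d : ℝ) + 4), mul_nonneg hd0 hd0]
  have hB' : 1024 * ((d : ℝ) + 1) * (d + 4) * ((L : ℝ) ^ 4 * ε₀) ≤ 1 / 3 :=
    (mul_le_mul_of_nonneg_right hK (by positivity)).trans h1
  have hB : 2 * ((L : ℝ) ^ 2 * ε₀) ≤ c2' d L := by
    unfold c2'
    rw [le_div_iff₀ hpos]
    have : 2 * ((L : ℝ) ^ 2 * ε₀) * (512 * ((d : ℝ) + 1) * (d + 4) * (L : ℝ) ^ 2)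
        = 1024 * ((d : ℝ) + 1) * (d + 4) * ((L : ℝ) ^ 4 * ε₀) := by ring
    rw [this]; linarith
  refine ⟨hA, hB, ?_⟩
  have hB2 := hB
  unfold c2' at hB2
  rw [le_div_iff₀ hpos] at hB2
  nlinarith [hB2]

/-- **The remark, explicit, for a gauge group closed under (42) at radius `t`** (`AvgClosedAt`; `SU(N)`, `U(N)`):
`L ≥ 2`, admissible domains, `U` `G`-valued in the space (6) = `𝔘_k({Ω_j}, ε₀) ∩ 𝔅_k(𝔅_k, V)`, and `α₀ = L²ε₀` within
the smallness of Prop. 2 of [4] (`C₀α₀ ≤ ⅓`, `2α₀ ≤ c₂′`, `32(d+1)(d+4)L²α₀ ≤ t`) ⟹ `V` satisfies (7) with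
`ε₁ = 2L²ε₀`. [cite: Balaban1985Variational, p.278 (remark after (7)); Balaban1985Averaging, Prop. 2 (54) p.26] -/
theorem reg7_of_nonempty_at (L : ℕ) (hL : 2 ≤ L) {G : Subgroup 𝔸ˣ} {t : ℝ} (hG : AvgClosedAt d t L G) {k : ℕ}
    {Ω : ℕ → Set (Site d)} (hΩ : DomainSeq L Ω) (h0 : Ω 0 = Set.univ) {η ε₀ : ℝ} (hε : 0 < ε₀)
    (hC : C0 d * ((L : ℝ) ^ 2 * ε₀) ≤ 1 / 3) (hc2 : 2 * ((L : ℝ) ^ 2 * ε₀) ≤ c2' d L)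
    (ht : 32 * ((d : ℝ) + 1) * (d + 4) * (L : ℝ) ^ 2 * ((L : ℝ) ^ 2 * ε₀) ≤ t)
    {U : Site d → Fin d → 𝔸ˣ} (hU : ∀ x κ, U x κ ∈ G) (hA : InAk L k η ε₀ Ω U)
    {V : ℕ → Site d → Fin d → 𝔸ˣ} (hB : InB L k Ω V U) : Reg7 L k Ω (2 * (L : ℝ) ^ 2 * ε₀) V := by
  intro j hjk y μ ν hμν hp
  have hL1 : 1 ≤ L := le_trans (by norm_num) hL
  rw [plaqF_effCfg_eq hL1 hΩ h0 hB hjk hμν hp]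
  have h52 := pdevOn_corners_lt hL1 hΩ h0 hε hA hjk hμν hp.1
  have h54 := prop2_local_at L hL hG j U hU (α₀ := (L : ℝ) ^ 2 * ε₀) (by positivity) hC hc2 ht y μ ν h52
  have h2 := B7.prop2_bound_lt_two_alpha (C0 d) ((L : ℝ) ^ 2 * ε₀) (by positivity) hC
  unfold plaqF
  linarith

/-- **The remark for an `AvgClosed` gauge group** (radius `1/4`: `U(N)`, the unitary group of a C⋆-algebra), with the
one threshold `L⁴ε₀ ≤ 1/(3C₀(d))`: the space (6) non-empty ⟹ `V` satisfies (7) with `ε₁ = 2L²ε₀ = O(ε₀)`.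
[cite: Balaban1985Variational, p.278 (remark after (7))] -/
theorem reg7_of_nonempty (L : ℕ) (hL : 2 ≤ L) {G : Subgroup 𝔸ˣ} (hG : AvgClosed d L G) {k : ℕ}
    {Ω : ℕ → Set (Site d)} (hΩ : DomainSeq L Ω) (h0 : Ω 0 = Set.univ) {η ε₀ : ℝ} (hε : 0 < ε₀)
    (hsmall : (L : ℝ) ^ 4 * ε₀ ≤ 1 / (3 * C0 d)) {V : ℕ → Site d → Fin d → 𝔸ˣ}
    (h6 : ∃ U : Site d → Fin d → 𝔸ˣ, (∀ x κ, U x κ ∈ G) ∧ InAk L k η ε₀ Ω U ∧ InB L k Ω V U) :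
    Reg7 L k Ω (2 * (L : ℝ) ^ 2 * ε₀) V := by
  obtain ⟨U, hU, hA, hB⟩ := h6
  obtain ⟨hC, hc2, ht⟩ := smallness_of_L4 (d := d) (le_trans (by norm_num) hL) hε.le hsmall
  exact reg7_of_nonempty_at L hL (avgClosedAt_of_avgClosed hG le_rfl) hΩ h0 hε hC hc2 ht hU hA hB

omit [NormOneClass 𝔸] [NormedAlgebra ℂ 𝔸] [CompleteSpace 𝔸] in
/-- The four corner blocks of a plaquette all of whose vertices lie in `Ω_j^{(j)}` (e.g. `p′ ⊂ Λ_j`) lie in `Ω_j`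
(`Ω_j = B^j(Ω_j^{(j)})`). [cite: Balaban1985Variational, (1) p.277, p.278 ("If p′ ⊂ Λ_j …")] -/
theorem box_subset_of_corners {L : ℕ} (hL : 1 ≤ L) {Ω : ℕ → Set (Site d)} (hΩ : DomainSeq L Ω) {j : ℕ}
    {y : Site d} {μ ν : Fin d} (hμν : μ ≠ ν) (hin : ∀ c, IsCorner y μ ν c → loK L j c ∈ Ω j)
    {x : Site d} (hx : InBox (loK L j y) (plaqHiK L j y μ ν) x) : x ∈ Ω j := by
  obtain ⟨c, hc, hu⟩ := exists_corner_under hL j hμν hx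
  exact (mem_iff_of_under hL hΩ hu).2 (hin c hc)

/-- **Print's "simple" case, sharper constant:** for a plaquette of (7) all of whose vertices lie in `Ω_j^{(j)}` (in
particular `p′ ⊂ Λ_j`: "(∂V)(p′) = V(∂p′)"), the corner blocks lie in `Ω_j` itself, (2) gives (52) with `α₀ = ε₀`, and
`|(∂V)(p′) − 1| < 2ε₀`. [cite: Balaban1985Variational, p.278 (remark after (7)); Balaban1985Averaging, Prop. 2 (54) p.26] -/
theorem reg7_interior_at (L : ℕ) (hL : 2 ≤ L) {G : Subgroup 𝔸ˣ} {t : ℝ} (hG : AvgClosedAt d t L G) {k : ℕ}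
    {Ω : ℕ → Set (Site d)} (hΩ : DomainSeq L Ω) (h0 : Ω 0 = Set.univ) {η ε₀ : ℝ} (hε : 0 < ε₀)
    (hC : C0 d * ε₀ ≤ 1 / 3)
    (hc2 : 2 * ε₀ ≤ c2' d L) (ht : 32 * ((d : ℝ) + 1) * (d + 4) * (L : ℝ) ^ 2 * ε₀ ≤ t)
    {U : Site d → Fin d → 𝔸ˣ} (hU : ∀ x κ, U x κ ∈ G) (hA : InAk L k η ε₀ Ω U)
    {V : ℕ → Site d → Fin d → 𝔸ˣ} (hB : InB L k Ω V U) {j : ℕ} (hjk : j ≤ k) {y : Site d} {μ ν : Fin d}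
    (hμν : μ ≠ ν) (hp : PlaqB L k Ω j y μ ν) (hin : ∀ c, IsCorner y μ ν c → loK L j c ∈ Ω j) :
    ‖plaqF (effCfg L k Ω V j) μ ν y - 1‖ < 2 * ε₀ := by
  have hL1 : 1 ≤ L := le_trans (by norm_num) hL
  rw [plaqF_effCfg_eq hL1 hΩ h0 hB hjk hμν hp]
  have hpos : (0 : ℝ) < ε₀ * (((L : ℝ) ^ j)⁻¹) ^ 2 := by positivity
  have h52 : pdevOn (loK L j y) (plaqHiK L j y μ ν) U < ε₀ * (((L : ℝ) ^ j)⁻¹) ^ 2 := by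
    refine pdevOn_lt_of_forall hpos fun x μ' ν' hx _ => ?_
    rcases eq_or_ne μ' ν' with rfl | hne
    · rw [hol_plaqWord_self, Units.val_one, sub_self, norm_zero]; exact hpos
    · exact (hA j hjk).1 x μ' ν' hne (Or.inl (box_subset_of_corners hL1 hΩ hμν hin hx))
  have h54 := prop2_local_at L hL hG j U hU hε hC hc2 ht y μ ν h52
  have h2 := B7.prop2_bound_lt_two_alpha (C0 d) ε₀ hε hC
  unfold plaqF
  linarith

end Main

/-! ## §6 The row's typed shape `B11.Prop2OfB7Shape`, discharged for the concrete family -/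

section Concrete

variable {𝔸 : Type} [NormedRing 𝔸] [NormOneClass 𝔸] [NormedAlgebra ℂ 𝔸] [CompleteSpace 𝔸]

/-- **`B11.Prop2OfB7Shape` HOLDS for the concrete family** (every `L ≥ 2`, every `AvgClosed` gauge group — `U(N)`, the
unitary group of a C⋆-algebra —, every choice of the uninvolved data `X`), with `c₇ = 2L²` and
`a₇ = 1/(3C₀(d)L⁴)`: "if the space (6) is non-empty and ε₀ is sufficiently small, then by Proposition 2 [4] the
configuration V satisfies (7) with ε₁ = O(ε₀)". [cite: Balaban1985Variational, p.278 (remark after (7))] -/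
theorem prop2OfB7Shape_concrete (L : ℕ) (hL : 2 ≤ L) {G : Subgroup 𝔸ˣ} (hG : AvgClosed d L G)
    (X : OtherData d 𝔸 G) : B11.Prop2OfB7Shape (concreteVarProblem d 𝔸 L G X) := by
  have hC := C0_pos d
  have hLr : (0 : ℝ) < L := by exact_mod_cast lt_of_lt_of_le (by norm_num) hL
  refine ⟨2 * (L : ℝ) ^ 2, 1 / (3 * C0 d * (L : ℝ) ^ 4), by positivity, by positivity, ?_⟩
  intro i ε₀ hε hεa V h6
  obtain ⟨U, hA, hB⟩ := h6
  have hsmall : (L : ℝ) ^ 4 * ε₀ ≤ 1 / (3 * C0 d) := by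
    have h := mul_le_mul_of_nonneg_left hεa (by positivity : (0 : ℝ) ≤ (L : ℝ) ^ 4)
    rwa [show (L : ℝ) ^ 4 * (1 / (3 * C0 d * (L : ℝ) ^ 4)) = 1 / (3 * C0 d) by field_simp] at h
  have h := reg7_of_nonempty L hL hG i.adm i.top hε hsmall ⟨U.1, U.2, hA, hB⟩
  simpa [concreteVarProblem, mul_assoc] using h

end Concrete

section UnitaryConcrete

variable {𝔸 : Type} [CStarAlgebra 𝔸] [Nontrivial 𝔸]

/-- **`B11.Prop2OfB7Shape` for unitary configurations** (`G` = the unitary group of a non-trivial C⋆-algebra `𝔸`;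
`𝔸 = M_N(ℂ)` with the operator norm is `G = U(N)`), every `L ≥ 2`. [cite: Balaban1985Variational, p.278 (remark after (7))] -/
theorem prop2OfB7Shape_unitaryUnits (L : ℕ) (hL : 2 ≤ L) (X : OtherData d 𝔸 (unitaryUnits 𝔸)) :
    B11.Prop2OfB7Shape (concreteVarProblem d 𝔸 L (unitaryUnits 𝔸) X) :=
  prop2OfB7Shape_concrete L hL (avgClosed_unitaryUnits d L) X

end UnitaryConcrete

section Matrices

open scoped Matrix.Norms.L2Operator

/-- **The paper's setting `G = U(N) ⊂ M_N(ℂ)`** (operator norm, (19) of [4]), every `N ≥ 1`, `L ≥ 2`: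
`B11.Prop2OfB7Shape` for the concrete family of `U(N)`-valued configurations on the lattices `ℤ^d`.
[cite: Balaban1985Variational, p.278 (remark after (7))] -/
theorem prop2OfB7Shape_unitaryGroup (N : ℕ) [NeZero N] (L : ℕ) (hL : 2 ≤ L)
    (X : OtherData d (Matrix (Fin N) (Fin N) ℂ) (unitaryUnits (Matrix (Fin N) (Fin N) ℂ))) :
    B11.Prop2OfB7Shape (concreteVarProblem d (Matrix (Fin N) (Fin N) ℂ) L (unitaryUnits _) X) := by
  letI : CStarAlgebra (Matrix (Fin N) (Fin N) ℂ) := {}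
  exact prop2OfB7Shape_concrete L hL (avgClosed_unitaryUnits d L) X

end Matrices

end Literature.MathematicalPhysics.QuantumFieldTheory.Balaban1983to89.B11Rem278
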